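import Summits.BirchSwinnertonDyer.BirchSwinnertonDyer.Theorems.QuadraticBranchSignedControlPlusEtaNonsurjThetaFunctionalEquationNormCoordinateZeroPairs
import HarnessLib

/-!
# Route `QuadraticBranchSignedControl` (rung K8, cell `bsd-potss`), residual crux `PlusEtaMainConjectureNonsurj`
# (stmt-BirchSwinnertonDyer-19606): THE FUNCTIONAL EQUATION ON THE QUADRATIC BRANCH, XXX — A ONE-DIGIT TEST FOR RATIONAL ZEROS:
# **a nonzero solution of `ι M = w(1+T)^e M` with a zero `t ∈ pℤ_p ∖ {0}` has `p² ∣ coeff_{ord_T M}(M)`**; so if the LOWEST nonzero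
# coefficient of `L_p^±(V, η, X)` is not divisible by `p²`, `L` has NO `ℤ_p`-rational zero in the punctured open disc
# (seat `bsd-potss-k8eta-c2` g30; kernel, class-wide, fact-free)

WHY. Parts XXVI/XXVIII: `P = T^{r₀}(1+T)^k H(Z)` and `M(t) = 0`, `t ≠ 0` ⟹ `H(t + t^ι) = 0` with the norm `t + t^ι = S(t)²` a square of
an element of `pℤ_p`, hence in `p²ℤ_p`. A root `z₀ ∈ p²ℤ_p` of `H` forces `p² ∣ H(0) = h₀` (`z₀ ∣ H(z₀) − H(0)`), and `h₀` IS the lowest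
nonzero coefficient of the Weierstrass polynomial (`coeff_{r₀} P = h₀`), so `coeff_{r₀} M = p^μ·h₀·U(0)` is divisible by `p²`. Contrapositively
**`p² ∤ coeff_{r₀}(M)` ⟹ `M` has no zero in `pℤ_p ∖ {0}`** — a ONE-DIGIT certificate, readable on the Mazur–Tate side by the lineage's quotient
readings (g26) at level `4`: in the display P-30Z (k8eta-c2 g30, 44 level-4 rows at `p = 5`) the digit `h₀ = coeff_{r₀}(P) mod 25` is NONZERO on
17 of the 36 rows with `λ > r₀`, so on those 17 rows `L_5⁺(V, η, X)` has no zero in `5ℤ_5 ∖ {0}` (all its `λ − r₀` nonzero zeros are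
irrational over `ℚ_5`); the other 19 are undecided at level 4.

MATHEMATICS. (§88) `coeff_0(normPoly H) = h_0`; `↑P = T^{r₀}(1+T)^k H(Z)`, `M = p^m·↑P·U` ⟹ `coeff_{r₀} M = p^m·h₀·U(0)`. (§89) `H(z₀) = 0`,
`p² ∣ z₀` ⟹ `p² ∣ h₀` (`Polynomial.sub_dvd_eval_sub`). (§90) `‖t‖ < 1`, `(1+t)(1+t') = 1` ⟹ `p² ∣ t + t'` (`t + t' = S(t)²`, `p ∣ S(t)`).
(§91) assemble with Parts XVI (`exists_weierstrass_of_ne_zero`), XXVI, XXVIII. (§92) the quadratic branch.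

WHAT. §88 `coeff_normPoly_zero`, `coeff_X_pow_mul_normPoly`, **`coeff_order_eq_of_normForm`**; §89 `sq_dvd_coeff_zero_of_root`; §90
`natCast_dvd_of_norm_lt_one`, **`natCast_sq_dvd_add_partner`**; §91 **`natCast_sq_dvd_coeff_order_of_zero`**, **`evalHom_ne_zero_of_not_sq_dvd`**;
§92 `natCast_sq_dvd_coeff_order_of_zero_of_isQuadraticBranch{Plus,Minus}LFunction`, `evalHom_ne_zero_{plus,minus}_row_of_not_sq_dvd`;
§93 (appended) `natCast_sq_dvd_weierstrass_coeff_order_of_zero`, `evalHom_ne_zero_of_not_sq_dvd_weierstrass_coeff`, `evalHom_ne_zero_plus_row_of_not_sq_dvd_weierstrass_coeff`.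

HONEST FRAMING (cell `bsd-potss`; FULL-BSD rank ≤ 1 programme, HUMAN RULING D-0036/D-0074): TOOL THEOREMS ONLY — no definition, no named
fact, no `sorry`, axioms standard; nothing about (A), (C1⁺_η), C-cc-1 or `BSD(W,p)` of any pair is claimed; no stub of 19606 is proved;
crux and route OPEN; nothing booked. `--supports stmt-BirchSwinnertonDyer-19606`.

References: [Washington1997] §7.1, §13.2; [MazurTateTeitelbaum1986Invent] §I.17; [GreenbergLNM1716] §1, §5; [Pollack2003] Thm. 5.13.
Tree: Parts XV, XVI, XXVI, XXVIII, XXIX; Mathlib `Polynomial.sub_dvd_eval_sub`, `PadicInt.norm_lt_one_iff_dvd`.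
-/

set_option autoImplicit false
set_option linter.dupNamespace false
noncomputable section

open scoped Classical MatrixGroups ModularForm Topology

open PowerSeries CongruenceSubgroup WeierstrassCurve Literature.NumberTheory.EllipticCurves Literature.NumberTheory.EllipticCurves.ModularForms
open Literature.NumberTheory.EllipticCurves.IwasawaAlgebra
open Summit.BirchSwinnertonDyer.Rank1Residual.Additive
open Summit.BirchSwinnertonDyer.Rank1Residual.X1.MuLambda (mu lam)

namespace Summit.BirchSwinnertonDyer.BirchSwinnertonDyer.Theorems.EtaThetaFunctionalEquation

variable {p : ℕ} [hp : Fact p.Prime] {r : ℤ_[p]} {S Z : IwasawaAlgebra p}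

/-! ## §88 The lowest coefficient of the Weierstrass polynomial is `h₀ = H(0)` -/

/-- `coeff_0 (Σ h_i T^{2i}(1+T)^{k−i}) = h_0`. [folklore] -/
theorem coeff_normPoly_zero (H : Polynomial ℤ_[p]) :
    (∑ i ∈ Finset.range (H.natDegree + 1),
        Polynomial.C (H.coeff i) * Polynomial.X ^ (2 * i) * (1 + Polynomial.X) ^ (H.natDegree - i) : Polynomial ℤ_[p]).coeff 0 =
      H.coeff 0 := by
  rw [Polynomial.finsetSum_coeff, Finset.sum_eq_single 0]
  · rw [mul_zero, pow_zero, mul_one, Polynomial.coeff_C_mul, Nat.sub_zero, Polynomial.coeff_one_add_X_pow, Nat.choose_zero_right,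
      Nat.cast_one, mul_one]
  · intro i _ hi
    rw [mul_assoc, Polynomial.coeff_C_mul, Polynomial.coeff_X_pow_mul', if_neg (by omega), mul_zero]
  · intro h; exact absurd (Finset.mem_range.mpr (Nat.succ_pos _)) h

/-- `coeff_{r₀} (T^{r₀} · normPoly H) = h_0`. [folklore] -/
theorem coeff_X_pow_mul_normPoly (H : Polynomial ℤ_[p]) (r₀ : ℕ) :
    (Polynomial.X ^ r₀ * ∑ i ∈ Finset.range (H.natDegree + 1),
        Polynomial.C (H.coeff i) * Polynomial.X ^ (2 * i) * (1 + Polynomial.X) ^ (H.natDegree - i) : Polynomial ℤ_[p]).coeff r₀ =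
      H.coeff 0 := by
  rw [Polynomial.coeff_X_pow_mul', if_pos le_rfl, Nat.sub_self, coeff_normPoly_zero]

/-- **`coeff_{r₀}(M) = p^m · h₀ · U(0)`** for `M = p^m·P·U` with `↑P = T^{r₀}·(1+T)^k·H(Z)` (`Z = T + ιT`): the lowest nonzero coefficient of
`M` is the constant term of the norm-coordinate polynomial `H`, up to `p^μ` and a unit. [cite: Washington1997, §7.1] -/
theorem coeff_order_eq_of_normForm (hZ : Z = X + invol p X) {M U : IwasawaAlgebra p} {m r₀ k : ℕ} {P H : Polynomial ℤ_[p]}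
    (hMP : M = C ((p : ℤ_[p]) ^ m) * (P : IwasawaAlgebra p) * U)
    (hPZ : (P : IwasawaAlgebra p) = X ^ r₀ * (1 + X) ^ k * PowerSeries.subst Z (H : IwasawaAlgebra p)) :
    coeff r₀ M = (p : ℤ_[p]) ^ m * H.coeff 0 * constantCoeff U := by
  have h1 : M = X ^ r₀ * (C ((p : ℤ_[p]) ^ m) * ((1 + X) ^ k * PowerSeries.subst Z (H : IwasawaAlgebra p)) * U) := by
    rw [hMP, hPZ]; ring
  rw [h1, coeff_X_pow_mul', if_pos le_rfl, Nat.sub_self, coeff_zero_eq_constantCoeff, map_mul, map_mul, map_mul, constantCoeff_C, map_pow,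
    map_add, map_one, constantCoeff_X, add_zero, one_pow, one_mul, constantCoeff_subst_trace hZ, ← coeff_zero_eq_constantCoeff_apply,
    Polynomial.coeff_coe]

/-! ## §89 A root of `H` in `p²ℤ_p` forces `p² ∣ h₀` -/

/-- `H(z₀) = 0` and `d ∣ z₀` ⟹ `d ∣ H(0) = h₀` (`z₀ − 0 ∣ H(z₀) − H(0)`). [folklore] -/
theorem dvd_coeff_zero_of_root {H : Polynomial ℤ_[p]} {z₀ d : ℤ_[p]} (hz : H.eval z₀ = 0) (hd : d ∣ z₀) : d ∣ H.coeff 0 := by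
  have h := Polynomial.sub_dvd_eval_sub z₀ 0 H
  rw [sub_zero, hz, zero_sub, dvd_neg, ← Polynomial.coeff_zero_eq_eval_zero] at h
  exact hd.trans h

/-! ## §90 The norm of a disc point lies in `p²ℤ_p` -/

/-- `‖x‖ < 1 ⟹ p ∣ x` in `ℤ_p`. [folklore] -/
theorem natCast_dvd_of_norm_lt_one {x : ℤ_[p]} (hx : ‖x‖ < 1) : (p : ℤ_[p]) ∣ x := (PadicInt.norm_lt_one_iff_dvd x).mp hx

/-- **`p² ∣ t + t^ι`** for every disc point `t` (`‖t‖ < 1`, `p` odd): `t + t^ι = S(t)²` with `S(t) ∈ pℤ_p`. [cite: MazurTateTeitelbaum1986Invent, §I.17] -/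
theorem natCast_sq_dvd_add_partner (hp2 : p ≠ 2) {t t' : ℤ_[p]} (ht : ‖t‖ < 1) (htt : (1 + t) * (1 + t') = 1) :
    (p : ℤ_[p]) ^ 2 ∣ t + t' := by
  obtain ⟨r, hr⟩ := exists_two_mul_eq_neg_one (p := p) hp2
  rw [← evalHom_sqrtZ_sq hr rfl ht htt]
  exact pow_dvd_pow_of_dvd (natCast_dvd_of_norm_lt_one (norm_evalHom_lt_one_of_constantCoeff_eq_zero (constantCoeff_sqrtZ rfl) ht)) 2

/-! ## §91 The one-digit test -/

/-- **A RATIONAL ZERO FORCES `p² ∣ coeff_{ord_T M}(M)`.** `p` odd, `M ≠ 0` with `ι M = w·(1+T)^e·M`; if `M(t) = 0` for some `t ∈ ℤ_p` with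
`0 < ‖t‖ < 1`, then `p²` divides the lowest nonzero coefficient `coeff_{r₀} M`, `r₀ = ord_T M`. (Datum-free; proof through the norm coordinate:
`H(t + t^ι) = 0`, `p² ∣ t + t^ι`, `p² ∣ h₀`, `coeff_{r₀} M = p^μ h₀ U(0)`.) [cite: Washington1997, §7.1, §13.2] [cite: MazurTateTeitelbaum1986Invent, §I.17] -/
theorem natCast_sq_dvd_coeff_order_of_zero (hp2 : p ≠ 2) {M : IwasawaAlgebra p} (hM0 : M ≠ 0) {w e : ℤ_[p]}
    (hFE : invol p M = C w * binomialSeries ℤ_[p] e * M) {t : ℤ_[p]} (ht : ‖t‖ < 1) (ht0 : t ≠ 0) (hzero : evalHom t ht M = 0) :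
    (p : ℤ_[p]) ^ 2 ∣ coeff (PowerSeries.order M).toNat M := by
  obtain ⟨r, hr⟩ := exists_two_mul_eq_neg_one (p := p) hp2
  obtain ⟨P, U, hP, hU, -, hMP⟩ := exists_weierstrass_of_ne_zero hM0
  obtain ⟨-, H, -, -, -, -, -, hPeq, hPZ, -⟩ :=
    weierstrass_eq_X_pow_mul_normPoly_of_invol_eq hr (S := X * binomialSeries ℤ_[p] r) rfl (Z := X + invol p X) rfl hM0 hFE hP hU hMP
  obtain ⟨t', htt⟩ := exists_partner_of_norm_lt_one ht
  have hpm : ((p : ℤ_[p]) ^ mu M) ≠ 0 := pow_ne_zero _ (Nat.cast_ne_zero.mpr hp.out.ne_zero)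
  have hroot : H.eval (t + t') = 0 := by
    rcases (evalHom_eq_zero_iff_of_eq_X_pow_mul_normPoly hPeq hpm hU hMP ht htt).mp hzero with ⟨h0, -⟩ | h
    · exact absurd h0 ht0
    · exact h
  rw [coeff_order_eq_of_normForm rfl hMP hPZ]
  exact Dvd.dvd.mul_right (Dvd.dvd.mul_left (dvd_coeff_zero_of_root hroot (natCast_sq_dvd_add_partner hp2 ht htt)) _) _

/-- **THE ONE-DIGIT TEST: `p² ∤ coeff_{ord_T M}(M)` ⟹ NO ZERO OF `M` IN `pℤ_p ∖ {0}`** (`p` odd, `M ≠ 0` a solution of `ι M = w(1+T)^e M`).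
[cite: Washington1997, §7.1, §13.2] [cite: MazurTateTeitelbaum1986Invent, §I.17] -/
theorem evalHom_ne_zero_of_not_sq_dvd (hp2 : p ≠ 2) {M : IwasawaAlgebra p} (hM0 : M ≠ 0) {w e : ℤ_[p]}
    (hFE : invol p M = C w * binomialSeries ℤ_[p] e * M) (hnd : ¬ (p : ℤ_[p]) ^ 2 ∣ coeff (PowerSeries.order M).toNat M)
    {t : ℤ_[p]} (ht : ‖t‖ < 1) (ht0 : t ≠ 0) : evalHom t ht M ≠ 0 :=
  fun hzero ↦ hnd (natCast_sq_dvd_coeff_order_of_zero hp2 hM0 hFE ht ht0 hzero)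

/-! ## §92 On the quadratic branch -/

section Branch

variable {N : ℕ} [NeZero N] {f : CuspForm (Gamma0 N) 2}

/-- **A `ℤ_p`-RATIONAL ZERO OF `L_p⁺(V, η, X)` IN THE PUNCTURED DISC FORCES `p² ∣ coeff_{ord L}(L)`** (`p` odd, `f` a rational newform of level
prime to `p`, `a_p(f) = 0`, ANY period ratio; no named fact). [cite: MazurTateTeitelbaum1986Invent, §I.17] [cite: Pollack2003, Thm. 5.13] -/
theorem natCast_sq_dvd_coeff_order_of_zero_of_isQuadraticBranchPlusLFunction (hp2 : p ≠ 2) (hf0 : IsNewform0 f) (hQ : coeffField f = ⊥)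
    (hpN : ¬ p ∣ N) (hap : cuspCoeff f p = ((0 : ℤ) : ℂ)) {ϖ : ℚ} {L : IwasawaAlgebra p} (hL : IsQuadraticBranchPlusLFunction f p ϖ L)
    (hL0 : L ≠ 0) {t : ℤ_[p]} (ht : ‖t‖ < 1) (ht0 : t ≠ 0) (hzero : evalHom t ht L = 0) :
    (p : ℤ_[p]) ^ 2 ∣ coeff (PowerSeries.order L).toNat L := by
  obtain ⟨σ, hσ, hW⟩ := exists_frickeSign_of_isNewform0 hf0
  obtain ⟨e, he⟩ := exists_invol_eq_of_isQuadraticBranchPlusLFunction hp2 hf0 hQ hpN hap hσ hW hL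
  exact natCast_sq_dvd_coeff_order_of_zero hp2 hL0 he ht ht0 hzero

/-- Minus twin of `natCast_sq_dvd_coeff_order_of_zero_of_isQuadraticBranchPlusLFunction`. [cite: MazurTateTeitelbaum1986Invent, §I.17] -/
theorem natCast_sq_dvd_coeff_order_of_zero_of_isQuadraticBranchMinusLFunction (hp2 : p ≠ 2) (hf0 : IsNewform0 f) (hQ : coeffField f = ⊥)
    (hpN : ¬ p ∣ N) (hap : cuspCoeff f p = ((0 : ℤ) : ℂ)) {ϖ : ℚ} {L : IwasawaAlgebra p} (hL : IsQuadraticBranchMinusLFunction f p ϖ L)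
    (hL0 : L ≠ 0) {t : ℤ_[p]} (ht : ‖t‖ < 1) (ht0 : t ≠ 0) (hzero : evalHom t ht L = 0) :
    (p : ℤ_[p]) ^ 2 ∣ coeff (PowerSeries.order L).toNat L := by
  obtain ⟨σ, hσ, hW⟩ := exists_frickeSign_of_isNewform0 hf0
  obtain ⟨e, he⟩ := exists_invol_eq_of_isQuadraticBranchMinusLFunction hp2 hf0 hQ hpN hap hσ hW hL
  exact natCast_sq_dvd_coeff_order_of_zero hp2 hL0 he ht ht0 hzero

/-- **AT A ROW (plus), THE ONE-DIGIT TEST**: `V` globally minimal, good at `p ≥ 5`, `a_p(V) = 0`, `f` its newform, ANY period ratio, any nonzero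
`Lη = L_p⁺(V, η, X)` whose lowest nonzero coefficient is NOT divisible by `p²`: `Lη(t) ≠ 0` for every `t ∈ ℤ_p` with `0 < ‖t‖ < 1` — all the
`λ − ord_T` nonzero zeros of `Lη` in the open disc are irrational over `ℚ_p`. Hypothesis-free beyond the row data and the digit.
[cite: MazurTateTeitelbaum1986Invent, §I.17] [cite: Pollack2003, Thm. 5.13] [cite: GreenbergLNM1716, §5] -/
theorem evalHom_ne_zero_plus_row_of_not_sq_dvd (hp5 : 5 ≤ p) (V : WeierstrassCurve ℚ) [V.IsElliptic] [V.IsGloballyMinimal]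
    (hgood : V.HasGoodReductionAtPrime p) (hap : V.frobeniusTrace p = 0) (hf : IsNewformOf V f) (ϖ : ℚ) {Lη : IwasawaAlgebra p}
    (hL : IsQuadraticBranchPlusLFunction f p ϖ Lη) (hL0 : Lη ≠ 0)
    (hnd : ¬ (p : ℤ_[p]) ^ 2 ∣ coeff (PowerSeries.order Lη).toNat Lη) {t : ℤ_[p]} (ht : ‖t‖ < 1) (ht0 : t ≠ 0) :
    evalHom t ht Lη ≠ 0 := by
  have hp2 : p ≠ 2 := by omega
  have hap' : cuspCoeff f p = ((0 : ℤ) : ℂ) := by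
    rw [cuspCoeff_eq_frobeniusTrace_of_isNewformOf_holds hf hgood, hap]
  exact fun hzero ↦ hnd (natCast_sq_dvd_coeff_order_of_zero_of_isQuadraticBranchPlusLFunction hp2 hf.1 hf.coeffField_eq_bot
    (not_dvd_level_of_isNewformOf hf hgood) hap' hL hL0 ht ht0 hzero)

/-- **AT A ROW (minus), THE ONE-DIGIT TEST** for `L_p⁻(V, η, X)`. [cite: MazurTateTeitelbaum1986Invent, §I.17] [cite: Pollack2003, Thm. 5.13] -/
theorem evalHom_ne_zero_minus_row_of_not_sq_dvd (hp5 : 5 ≤ p) (V : WeierstrassCurve ℚ) [V.IsElliptic] [V.IsGloballyMinimal]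
    (hgood : V.HasGoodReductionAtPrime p) (hap : V.frobeniusTrace p = 0) (hf : IsNewformOf V f) (ϖ : ℚ) {Lη : IwasawaAlgebra p}
    (hL : IsQuadraticBranchMinusLFunction f p ϖ Lη) (hL0 : Lη ≠ 0)
    (hnd : ¬ (p : ℤ_[p]) ^ 2 ∣ coeff (PowerSeries.order Lη).toNat Lη) {t : ℤ_[p]} (ht : ‖t‖ < 1) (ht0 : t ≠ 0) :
    evalHom t ht Lη ≠ 0 := by
  have hp2 : p ≠ 2 := by omega
  have hap' : cuspCoeff f p = ((0 : ℤ) : ℂ) := by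
    rw [cuspCoeff_eq_frobeniusTrace_of_isNewformOf_holds hf hgood, hap]
  exact fun hzero ↦ hnd (natCast_sq_dvd_coeff_order_of_zero_of_isQuadraticBranchMinusLFunction hp2 hf.1 hf.coeffField_eq_bot
    (not_dvd_level_of_isNewformOf hf hgood) hap' hL hL0 ht ht0 hzero)

end Branch

/-! ## §93 (appended) Normalisation-free form: `p² ∣ coeff_{r₀}(P)` for ANY Weierstrass datum

The digit read in the censuses (P-29R / P-30Z / P-30L) is the lowest nonzero coefficient `h₀ = coeff_{r₀}(P)` of the Weierstrass POLYNOMIAL,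
which is normalisation-free (Part XXI: independent of the period ratio and of `p^μ`); the test in that currency. -/

/-- **A RATIONAL ZERO FORCES `p² ∣ coeff_{ord_T M}(P)` FOR EVERY WEIERSTRASS DATUM `M = p^m·P·U`** (`p` odd, `M ≠ 0`, `ι M = w(1+T)^e M`,
`M(t) = 0` for some `t ∈ ℤ_p`, `0 < ‖t‖ < 1`): `P = T^{r₀}·normPoly H`, `H(t + t^ι) = 0`, `p² ∣ t + t^ι` ⟹ `p² ∣ h₀ = coeff_{r₀}(P)`.
[cite: Washington1997, §7.1, §13.2] [cite: MazurTateTeitelbaum1986Invent, §I.17] -/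
theorem natCast_sq_dvd_weierstrass_coeff_order_of_zero (hp2 : p ≠ 2) {M : IwasawaAlgebra p} (hM0 : M ≠ 0) {w e : ℤ_[p]}
    (hFE : invol p M = C w * binomialSeries ℤ_[p] e * M) {m : ℕ} {P : Polynomial ℤ_[p]}
    (hP : P.IsDistinguishedAt (IsLocalRing.maximalIdeal ℤ_[p])) {U : IwasawaAlgebra p} (hU : IsUnit U)
    (hMP : M = C ((p : ℤ_[p]) ^ m) * (P : IwasawaAlgebra p) * U) {t : ℤ_[p]} (ht : ‖t‖ < 1) (ht0 : t ≠ 0) (hzero : evalHom t ht M = 0) :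
    (p : ℤ_[p]) ^ 2 ∣ P.coeff (PowerSeries.order M).toNat := by
  obtain ⟨r, hr⟩ := exists_two_mul_eq_neg_one (p := p) hp2
  obtain ⟨-, H, -, -, -, -, -, hPeq, -, -⟩ :=
    weierstrass_eq_X_pow_mul_normPoly_of_invol_eq hr (S := X * binomialSeries ℤ_[p] r) rfl (Z := X + invol p X) rfl hM0 hFE hP hU hMP
  obtain ⟨t', htt⟩ := exists_partner_of_norm_lt_one ht
  have hpm : ((p : ℤ_[p]) ^ m) ≠ 0 := pow_ne_zero _ (Nat.cast_ne_zero.mpr hp.out.ne_zero)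
  have hroot : H.eval (t + t') = 0 := by
    rcases (evalHom_eq_zero_iff_of_eq_X_pow_mul_normPoly hPeq hpm hU hMP ht htt).mp hzero with ⟨h0, -⟩ | h
    · exact absurd h0 ht0
    · exact h
  rw [hPeq, coeff_X_pow_mul_normPoly]
  exact dvd_coeff_zero_of_root hroot (natCast_sq_dvd_add_partner hp2 ht htt)

/-- **THE ONE-DIGIT TEST IN WEIERSTRASS CURRENCY: `p² ∤ coeff_{ord_T M}(P)` ⟹ NO ZERO OF `M` IN `pℤ_p ∖ {0}`**, for any datum `M = p^m·P·U`
of a nonzero solution of the functional equation (`p` odd). [cite: Washington1997, §7.1, §13.2] [cite: MazurTateTeitelbaum1986Invent, §I.17] -/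
theorem evalHom_ne_zero_of_not_sq_dvd_weierstrass_coeff (hp2 : p ≠ 2) {M : IwasawaAlgebra p} (hM0 : M ≠ 0) {w e : ℤ_[p]}
    (hFE : invol p M = C w * binomialSeries ℤ_[p] e * M) {m : ℕ} {P : Polynomial ℤ_[p]}
    (hP : P.IsDistinguishedAt (IsLocalRing.maximalIdeal ℤ_[p])) {U : IwasawaAlgebra p} (hU : IsUnit U)
    (hMP : M = C ((p : ℤ_[p]) ^ m) * (P : IwasawaAlgebra p) * U) (hnd : ¬ (p : ℤ_[p]) ^ 2 ∣ P.coeff (PowerSeries.order M).toNat)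
    {t : ℤ_[p]} (ht : ‖t‖ < 1) (ht0 : t ≠ 0) : evalHom t ht M ≠ 0 :=
  fun hzero ↦ hnd (natCast_sq_dvd_weierstrass_coeff_order_of_zero hp2 hM0 hFE hP hU hMP ht ht0 hzero)

section BranchWeierstrass

variable {N : ℕ} [NeZero N] {f : CuspForm (Gamma0 N) 2}

/-- **AT A ROW (plus), THE ONE-DIGIT TEST IN WEIERSTRASS CURRENCY**: `V` globally minimal, good at `p ≥ 5`, `a_p(V) = 0`, `f` its newform, ANY period
ratio, ANY nonzero `Lη = L_p⁺(V, η, X)`, ANY Weierstrass datum `Lη = p^m·P·U` whose lowest nonzero coefficient `coeff_{ord Lη}(P)` is NOT divisible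
by `p²`: `Lη(t) ≠ 0` for every `t ∈ ℤ_p` with `0 < ‖t‖ < 1`. (The digit is normalisation-free: Part XXI.) [cite: MazurTateTeitelbaum1986Invent, §I.17]
[cite: Pollack2003, Thm. 5.13] [cite: GreenbergLNM1716, §5] -/
theorem evalHom_ne_zero_plus_row_of_not_sq_dvd_weierstrass_coeff (hp5 : 5 ≤ p) (V : WeierstrassCurve ℚ) [V.IsElliptic]
    [V.IsGloballyMinimal] (hgood : V.HasGoodReductionAtPrime p) (hap : V.frobeniusTrace p = 0) (hf : IsNewformOf V f) (ϖ : ℚ)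
    {Lη : IwasawaAlgebra p} (hL : IsQuadraticBranchPlusLFunction f p ϖ Lη) (hL0 : Lη ≠ 0) {m : ℕ} {P : Polynomial ℤ_[p]}
    (hP : P.IsDistinguishedAt (IsLocalRing.maximalIdeal ℤ_[p])) {U : IwasawaAlgebra p} (hU : IsUnit U)
    (hLP : Lη = C ((p : ℤ_[p]) ^ m) * (P : IwasawaAlgebra p) * U) (hnd : ¬ (p : ℤ_[p]) ^ 2 ∣ P.coeff (PowerSeries.order Lη).toNat)
    {t : ℤ_[p]} (ht : ‖t‖ < 1) (ht0 : t ≠ 0) : evalHom t ht Lη ≠ 0 := by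
  have hp2 : p ≠ 2 := by omega
  have hap' : cuspCoeff f p = ((0 : ℤ) : ℂ) := by
    rw [cuspCoeff_eq_frobeniusTrace_of_isNewformOf_holds hf hgood, hap]
  obtain ⟨σ, hσ, hW⟩ := exists_frickeSign_of_isNewform0 hf.1
  obtain ⟨e, he⟩ := exists_invol_eq_of_isQuadraticBranchPlusLFunction hp2 hf.1 hf.coeffField_eq_bot (not_dvd_level_of_isNewformOf hf hgood)
    hap' hσ hW hL
  exact evalHom_ne_zero_of_not_sq_dvd_weierstrass_coeff hp2 hL0 he hP hU hLP hnd ht ht0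

end BranchWeierstrass

end Summit.BirchSwinnertonDyer.BirchSwinnertonDyer.Theorems.EtaThetaFunctionalEquation

end
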